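import Summits.QuantumFields.YangMills.Theorems.FluctuationComparisonRegPrIntLOrganTangentFibredChartDescendTo
import Literature.MathematicalPhysics.QuantumFieldTheory.Balaban1983to89.T4AveragingDisintegration
import HarnessLib

/-!
# `FluctuationComparisonRegPrIntLOrganTangentAPackageDescendTo` — (L16) THE m-STEP (A)-PACKAGE OF `descendTo F ℰp j K` ON THE MULTI-LEVEL WINDOW IS A THEOREM:
# the fibred-chart bridge for `descendTo` (BRIDGE-MW), and — from a height, for every family and every depth — the package with NO residual letter, in both the
# `∀ σ₀` and the `∃ σ₀` editions

Cell `ym3-torus` (rung R3 = continuum `SU(2)` Yang–Mills on T³ — NOT d = 4, NOT infinite volume, NOT a mass gap, NOT Clay), width seat `ym-ust-20520-w5` (gen 22),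
pen (L16) (offered 2026-08-30 23:39Z to LEAD-20520 w3 g24, first refusal).  `--kind proof --supports stmt-QuantumFields-20520 --as helper`, count-neutral, definition-free,
default heartbeats; THEOREMS ONLY; nothing printed is asserted.

WHAT.  The one-step (A)-package (✓(L8) `…APackageFromHeight`, ✓`…FibredChartFromHeight` §3) is the regular small-field disintegration of product Haar along ONE block averaging
`descend F ℰp j`.  The v18 O1ᵘ rows transport along `m` steps; by LEAD w3 g24 WORD №2 their localised fibre means are supported in the MULTI-LEVEL window
`MW_{j,K} = {U | ∀ n ∈ [j+1, K], PlaqSmall (24∕25·θ_n) (descendTo F ℰp n K U)}` (the product of the tower's own cut-offs, S3 clause ⑦).  ✓(L15-MW)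
`…FibredChartDescendTo.exists_height_fibredChart_descendTo` supplies the chart of `descendTo F ℰp j K` AS DATA on `MW` from a height; this file turns it into the package.
§1 `measurableSet_multiWindow`, ★`absolutelyContinuous_map_descendTo` (`(dU_K).map (descendTo j K) ≪ dU_j`, induction over ✓`absolutelyContinuous_map_descend`).
§2 ★★ BRIDGE-MW `regularPackage_descendTo_of_fibredChart` — ✓BRIDGE′c `…FibredChartBridgeIntegrandAnyCut.regularPackage_of_fibredChart_of_integrand`'s statement and proof with
`descend F ℰp j ↦ descendTo F ℰp j K`, fine level `j+1 ↦ K`, `cW`-window ↦ `MW_{j,K}` (lit ✓`Node00.RegSetOfFibredChart` is generic in the averaging map): for ONE disintegration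
`σ₀` of `dU_K` along `descendTo j K` and a chart `(Z, τ, Φ, J, S)` with `hS`-MW, `havgΦ`, `hmap` at the `θ_j`-window, (C1′)-MW, (C2), (C3)-MW ⟹ `∃ lam` finite with (A1-MW) window
continuity of `V ↦ ∫ f dlam_V` for continuous `f` supported in `MW`, (A2-MW) positive `lam_V`-mass of `MW`, (A3-MW) `∫ f dσ₀_V = c(V)·∫ f dlam_V` a.e. on the window.
§3 ★★★ FROM A HEIGHT, NO RESIDUAL LETTER: `exists_height_regularPackage_descendTo_forall` (`∀ σ₀`; §2 ∘ ✓(L15-MW)) and ★★★`exists_height_regularSmallFieldDisintegration_descendTo`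
(`∃ σ₀ lam`, with `σ₀ := T4AveragingDisintegration.condLaw` of `dU_K` along `descendTo`, as ✓(d)c §0): for every `F`, `0 < γ ≤ 1`, `0 < b₀`, `0 < p₀`, every `K ≥ j+1 ≥ jA+1`.
NOT HERE: the m-step organ rows themselves (VERᵐ∕JENᵐ∕O1ᵘ-H), their (M3)-type lift letters, anything of Bałaban's estimates.
[cite: Balaban1987RG1, (0.4) p.253, (0.11) p.253, (0.13) p.254 and (2.10) p.267; Balaban1985Averaging, (10)-(13) p.19; Balaban1985UV3, (7) p.257]

HONEST: measure-theoretic plumbing + compositions of landed kernel facts; nothing of Bałaban's RG estimates is asserted or proved; O1 ∕ O1ᵘ-H ∕ LIN∘ ∕ JVAR∘ ∕ UNIQ-MAX∘ ∕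
crux 20520 `FluctuationComparisonRegPrIntL` ∕ `YM3TorusSU2` NOT proved; registry `Lines/semiclassical_s2beta.lean` v11.4 (★★OWNER RULING №36) untouched; rung R3 = SU(2) YM₃
on T³ — NOT d = 4, NOT infinite volume, NOT a mass gap, NOT Clay; the Yang–Mills mass gap is NOT proved by any of this.
-/

set_option autoImplicit false

noncomputable section

namespace Summit.QuantumFields.YangMills.Theorems.FluctuationComparisonRegPrIntLOrganTangentAPackageDescendTo

open MeasureTheory ProbabilityTheory Filter Topology Set Function
open scoped ENNReal NNReal
open Literature.MathematicalPhysics.QuantumFieldTheory.Balaban1983to89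
open T3ContinuumYM3Torus T3NestedUnitLaws T3UnitLawDensityEML T3UnitScaleTilt T3LevelShift T3TiltDescent T4Continuum
open Literature.MathematicalPhysics.QuantumFieldTheory.Balaban1983to89.T3OrbitAverage
open Literature.MathematicalPhysics.QuantumFieldTheory.Balaban1983to89.T3DescentFibreTower (descendTo_descendTo descendTo_self)
open Summit.QuantumFields.YangMills.Theorems.OrganTangentFibreMeanTools
open Summit.QuantumFields.YangMills.Theorems.FluctuationComparisonRegPrIntLOrganTangentFibredChartDescendTo
  (descend_eq_descendTo' exists_height_fibredChart_descendTo)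

/-! ## §1 The multi-level window is measurable; `descendTo` pushes Haar forward absolutely continuously -/

/-- The multi-level window `MW_{j,K} = {U | ∀ n ∈ [j+1, K], PlaqSmall (24∕25·θ_n) (descendTo F ℰp n K U)}` is measurable (finitely many open windows pulled back along
measurable descents). [cite: Balaban1985UV3, (7) p.257] -/
theorem measurableSet_multiWindow (F : T3Family) (γ b₀ p₀ : ℝ) (j K : ℕ) :
    MeasurableSet {U : GaugeField (F.P K) 0 ↥(Matrix.specialUnitaryGroup (Fin 2) ℂ) | ∀ (n : ℕ) (hjn : j + 1 ≤ n) (hnK : n ≤ K),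
      PlaqSmall (24 / 25 * θBal F.L γ b₀ p₀ n) (descendTo F ℰp n K hnK U)} := by
  have hwin : ∀ (n : ℕ) (δ : ℝ), MeasurableSet {U : GaugeField (F.P n) 0 ↥(Matrix.specialUnitaryGroup (Fin 2) ℂ) | PlaqSmall δ U} := by
    intro n δ
    haveI : BorelSpace (GaugeField (F.P n) 0 ↥(Matrix.specialUnitaryGroup (Fin 2) ℂ)) := T3OrbitAverage.instBorelSpaceGaugeField
    have e : {U : GaugeField (F.P n) 0 ↥(Matrix.specialUnitaryGroup (Fin 2) ℂ) | PlaqSmall δ U} = ⋂ p : Plaq (F.P n) 0, {U | dist1 (GaugeField.plaqHol U p) < δ} := by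
      ext U; simp only [PlaqSmall, Set.mem_setOf_eq, Set.mem_iInter]
    rw [e]
    exact (isOpen_iInter_of_finite fun p => isOpen_lt (continuous_dist1_plaqHol p) continuous_const).measurableSet
  have e : {U : GaugeField (F.P K) 0 ↥(Matrix.specialUnitaryGroup (Fin 2) ℂ) | ∀ (n : ℕ) (hjn : j + 1 ≤ n) (hnK : n ≤ K),
      PlaqSmall (24 / 25 * θBal F.L γ b₀ p₀ n) (descendTo F ℰp n K hnK U)} =
      ⋂ (n : ℕ) (hjn : j + 1 ≤ n) (hnK : n ≤ K), (descendTo F ℰp n K hnK) ⁻¹' {U | PlaqSmall (24 / 25 * θBal F.L γ b₀ p₀ n) U} := by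
    ext U; simp only [Set.mem_setOf_eq, Set.mem_iInter, Set.mem_preimage]
  rw [e]
  exact MeasurableSet.iInter fun n => MeasurableSet.iInter fun hjn => MeasurableSet.iInter fun hnK =>
    (measurable_descendTo F ℰp measurableE_ℰp hnK) (hwin _ _)

/-- ★ **`(dU_K).map (descendTo F ℰp j K) ≪ dU_j`** — the push-forward of product Haar under the multi-step descent is absolutely continuous with respect to product Haar of the
coarser run (induction on `K` over ✓`OrganTangentFibreMeanTools.absolutelyContinuous_map_descend` and ✓`descendTo_descendTo`). [cite: Balaban1985Averaging, (10) p.19] -/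
theorem absolutelyContinuous_map_descendTo (F : T3Family) (j : ℕ) : ∀ (K : ℕ) (hjK : j ≤ K),
    (fieldMeasure (F.P K) 0 ↥(Matrix.specialUnitaryGroup (Fin 2) ℂ)).map (descendTo F ℰp j K hjK) ≪
      fieldMeasure (F.P j) 0 ↥(Matrix.specialUnitaryGroup (Fin 2) ℂ) := by
  intro K hjK
  induction K, hjK using Nat.le_induction with
  | base =>
    have e : (descendTo F ℰp j j le_rfl : GaugeField (F.P j) 0 ↥(Matrix.specialUnitaryGroup (Fin 2) ℂ) → GaugeField (F.P j) 0 ↥(Matrix.specialUnitaryGroup (Fin 2) ℂ)) = id :=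
      funext fun U => descendTo_self F ℰp j U
    rw [e, Measure.map_id]
  | succ K hjK IH =>
    have hd : Measurable (descend F ℰp K : GaugeField (F.P (K + 1)) 0 ↥(Matrix.specialUnitaryGroup (Fin 2) ℂ) → GaugeField (F.P K) 0 ↥(Matrix.specialUnitaryGroup (Fin 2) ℂ)) :=
      T3NestedUnitLaws.measurable_descend F ℰp measurableE_ℰp K
    have hdK : Measurable (descendTo F ℰp j K hjK : GaugeField (F.P K) 0 ↥(Matrix.specialUnitaryGroup (Fin 2) ℂ) → GaugeField (F.P j) 0 ↥(Matrix.specialUnitaryGroup (Fin 2) ℂ)) :=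
      measurable_descendTo F ℰp measurableE_ℰp hjK
    have e : (descendTo F ℰp j (K + 1) (by omega) : GaugeField (F.P (K + 1)) 0 ↥(Matrix.specialUnitaryGroup (Fin 2) ℂ) → GaugeField (F.P j) 0 ↥(Matrix.specialUnitaryGroup (Fin 2) ℂ)) =
        descendTo F ℰp j K hjK ∘ descend F ℰp K := by
      funext U
      show descendTo F ℰp j (K + 1) _ U = descendTo F ℰp j K hjK (descend F ℰp K U)
      rw [descend_eq_descendTo' F K (Nat.le_succ K) U, descendTo_descendTo]
    rw [e, ← Measure.map_map hdK hd]
    exact ((absolutelyContinuous_map_descend F K).map hdK).trans IH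

/-! ## §2 BRIDGE-MW: fibred chart of `descendTo` on the multi-level window ⟹ the (A)-package -/

/-- ★★ **BRIDGE-MW — FIBRED CHART OF `descendTo F ℰp j K` OVER THE COARSE WINDOW, SUPPORTED ON THE MULTI-LEVEL WINDOW ⟹ THE m-STEP (A)-PACKAGE** (for any ONE
disintegration `σ₀` of `dU_K` along `descendTo F ℰp j K`): ✓`OrganTangentFibredChartBridgeIntegrandAnyCut.regularPackage_of_fibredChart_of_integrand` with the one-step average
replaced by `descendTo F ℰp j K` and the `cW`-window by `MW_{j,K}`.  Data: a T⁴-style chart `(Z, τ, Φ, J, S)` with `MW ⊆ S`, `havgΦ`, `hmap` at the `θ_j`-window, (C1′)-MW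
a.e. in the fibre, a `τ`-integrable bound (C2), and the (C3)-MW mass.  Conclusion: `∃ lam`, finite, with (A1-MW) (A2-MW) (A3-MW).
[cite: Balaban1987RG1, (2.10) p.267 and (0.13) p.254; Balaban1985Averaging, (10) p.19; Balaban1985UV3, (7) p.257] -/
theorem regularPackage_descendTo_of_fibredChart
    (F : T3Family) (γ b₀ p₀ : ℝ) (j K : ℕ) (hjK : j ≤ K)
    (σ₀ : Kernel (GaugeField (F.P j) 0 ↥(Matrix.specialUnitaryGroup (Fin 2) ℂ))
      (GaugeField (F.P K) 0 ↥(Matrix.specialUnitaryGroup (Fin 2) ℂ)))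
    (hσ₀M : IsMarkovKernel σ₀)
    (hbind₀ : (Measure.map (descendTo F ℰp j K hjK) (fieldMeasure (F.P K) 0 ↥(Matrix.specialUnitaryGroup (Fin 2) ℂ))).bind ⇑σ₀ =
      fieldMeasure (F.P K) 0 ↥(Matrix.specialUnitaryGroup (Fin 2) ℂ))
    (hfib₀ : ∀ᵐ V ∂(Measure.map (descendTo F ℰp j K hjK) (fieldMeasure (F.P K) 0 ↥(Matrix.specialUnitaryGroup (Fin 2) ℂ))),
      ∀ᵐ U ∂(σ₀ V), descendTo F ℰp j K hjK U = V)
    {Z : Type*} [MeasurableSpace Z] (τ : Measure Z) [SFinite τ]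
    (Φ : GaugeField (F.P j) 0 ↥(Matrix.specialUnitaryGroup (Fin 2) ℂ) × Z → GaugeField (F.P K) 0 ↥(Matrix.specialUnitaryGroup (Fin 2) ℂ))
    (hΦ : Measurable Φ)
    (J : GaugeField (F.P j) 0 ↥(Matrix.specialUnitaryGroup (Fin 2) ℂ) × Z → ℝ≥0) (hJ : Measurable J)
    (S : Set (GaugeField (F.P K) 0 ↥(Matrix.specialUnitaryGroup (Fin 2) ℂ)))
    (hS : ∀ U, (∀ (n : ℕ) (hjn : j + 1 ≤ n) (hnK : n ≤ K), PlaqSmall (24 / 25 * θBal F.L γ b₀ p₀ n) (descendTo F ℰp n K hnK U)) → U ∈ S)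
    (havgΦ : ∀ V ∈ {V | PlaqSmall (θBal F.L γ b₀ p₀ j) V}, ∀ z, descendTo F ℰp j K hjK (Φ (V, z)) = V)
    (hmap : (fieldMeasure (F.P K) 0 ↥(Matrix.specialUnitaryGroup (Fin 2) ℂ)).restrict
        (descendTo F ℰp j K hjK ⁻¹' {V | PlaqSmall (θBal F.L γ b₀ p₀ j) V} ∩ S) =
      ((((fieldMeasure (F.P j) 0 ↥(Matrix.specialUnitaryGroup (Fin 2) ℂ)).restrict {V | PlaqSmall (θBal F.L γ b₀ p₀ j) V}).prod τ).withDensity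
        (fun p => (J p : ℝ≥0∞))).map Φ)
    (hint : ∀ f : GaugeField (F.P K) 0 ↥(Matrix.specialUnitaryGroup (Fin 2) ℂ) → ℝ, Continuous f →
      (∀ U, f U ≠ 0 → ∀ (n : ℕ) (hjn : j + 1 ≤ n) (hnK : n ≤ K), PlaqSmall (24 / 25 * θBal F.L γ b₀ p₀ n) (descendTo F ℰp n K hnK U)) →
      ∀ᵐ z ∂τ, ContinuousOn (fun V => (J (V, z) : ℝ) * f (Φ (V, z))) {V | PlaqSmall (θBal F.L γ b₀ p₀ j) V})
    (B : Z → ℝ) (hB : Integrable B τ)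
    (hJB : ∀ V, PlaqSmall (θBal F.L γ b₀ p₀ j) V → ∀ᵐ z ∂τ, (J (V, z) : ℝ) ≤ B z)
    (hmass : ∀ V, PlaqSmall (θBal F.L γ b₀ p₀ j) V →
      0 < ∫⁻ z in {z | ∀ (n : ℕ) (hjn : j + 1 ≤ n) (hnK : n ≤ K), PlaqSmall (24 / 25 * θBal F.L γ b₀ p₀ n) (descendTo F ℰp n K hnK (Φ (V, z)))},
        (J (V, z) : ℝ≥0∞) ∂τ) :
    ∃ lam : GaugeField (F.P j) 0 ↥(Matrix.specialUnitaryGroup (Fin 2) ℂ) →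
        Measure (GaugeField (F.P K) 0 ↥(Matrix.specialUnitaryGroup (Fin 2) ℂ)),
      (∀ V, IsFiniteMeasure (lam V)) ∧
      (∀ f : GaugeField (F.P K) 0 ↥(Matrix.specialUnitaryGroup (Fin 2) ℂ) → ℝ, Continuous f →
        (∀ U, f U ≠ 0 → ∀ (n : ℕ) (hjn : j + 1 ≤ n) (hnK : n ≤ K), PlaqSmall (24 / 25 * θBal F.L γ b₀ p₀ n) (descendTo F ℰp n K hnK U)) →
        ContinuousOn (fun V => ∫ U, f U ∂(lam V)) {V | PlaqSmall (θBal F.L γ b₀ p₀ j) V}) ∧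
      (∀ V, PlaqSmall (θBal F.L γ b₀ p₀ j) V → 0 < lam V {U | ∀ (n : ℕ) (hjn : j + 1 ≤ n) (hnK : n ≤ K),
        PlaqSmall (24 / 25 * θBal F.L γ b₀ p₀ n) (descendTo F ℰp n K hnK U)}) ∧
      (∃ c : GaugeField (F.P j) 0 ↥(Matrix.specialUnitaryGroup (Fin 2) ℂ) → ℝ,
        ∀ f : GaugeField (F.P K) 0 ↥(Matrix.specialUnitaryGroup (Fin 2) ℂ) → ℝ, Continuous f →
          (∀ U, ¬ (∀ (n : ℕ) (hjn : j + 1 ≤ n) (hnK : n ≤ K), PlaqSmall (24 / 25 * θBal F.L γ b₀ p₀ n) (descendTo F ℰp n K hnK U)) → f U = 0) →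
          ∀ᵐ V ∂(Measure.map (descendTo F ℰp j K hjK) (fieldMeasure (F.P K) 0 ↥(Matrix.specialUnitaryGroup (Fin 2) ℂ))),
            PlaqSmall (θBal F.L γ b₀ p₀ j) V → 0 < c V ∧ ∫ U, f U ∂(σ₀ V) = c V * ∫ U, f U ∂(lam V)) := by
  classical
  haveI := hσ₀M
  haveI : BorelSpace (GaugeField (F.P K) 0 ↥(Matrix.specialUnitaryGroup (Fin 2) ℂ)) := T3OrbitAverage.instBorelSpaceGaugeField
  haveI : BorelSpace (GaugeField (F.P j) 0 ↥(Matrix.specialUnitaryGroup (Fin 2) ℂ)) := T3OrbitAverage.instBorelSpaceGaugeField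
  -- abbreviations
  set θj : ℝ := θBal F.L γ b₀ p₀ j with hθj
  set Hf : Measure (GaugeField (F.P K) 0 ↥(Matrix.specialUnitaryGroup (Fin 2) ℂ)) := fieldMeasure (F.P K) 0 ↥(Matrix.specialUnitaryGroup (Fin 2) ℂ) with hHf
  set Hc : Measure (GaugeField (F.P j) 0 ↥(Matrix.specialUnitaryGroup (Fin 2) ℂ)) := fieldMeasure (F.P j) 0 ↥(Matrix.specialUnitaryGroup (Fin 2) ℂ) with hHc
  haveI : IsProbabilityMeasure Hf := Missing.isProbabilityMeasure_fieldMeasure _ _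
  haveI : IsProbabilityMeasure Hc := Missing.isProbabilityMeasure_fieldMeasure _ _
  have hd : Measurable (descendTo F ℰp j K hjK :
      GaugeField (F.P K) 0 ↥(Matrix.specialUnitaryGroup (Fin 2) ℂ) → GaugeField (F.P j) 0 ↥(Matrix.specialUnitaryGroup (Fin 2) ℂ)) :=
    measurable_descendTo F ℰp measurableE_ℰp hjK
  set ν : Measure (GaugeField (F.P j) 0 ↥(Matrix.specialUnitaryGroup (Fin 2) ℂ)) := Hf.map (descendTo F ℰp j K hjK) with hν
  haveI : IsProbabilityMeasure ν := Measure.isProbabilityMeasure_map hd.aemeasurable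
  set W : Set (GaugeField (F.P j) 0 ↥(Matrix.specialUnitaryGroup (Fin 2) ℂ)) := {V | PlaqSmall θj V} with hW
  set O₃ : Set (GaugeField (F.P K) 0 ↥(Matrix.specialUnitaryGroup (Fin 2) ℂ)) := {U | ∀ (n : ℕ) (hjn : j + 1 ≤ n) (hnK : n ≤ K),
    PlaqSmall (24 / 25 * θBal F.L γ b₀ p₀ n) (descendTo F ℰp n K hnK U)} with hO₃
  have hWopen : IsOpen W := by
    have e : W = ⋂ p : Plaq (F.P j) 0, {U | dist1 (GaugeField.plaqHol U p) < θj} := by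
      ext U; simp only [hW, PlaqSmall, Set.mem_setOf_eq, Set.mem_iInter]
    rw [e]
    exact isOpen_iInter_of_finite fun p => isOpen_lt (continuous_dist1_plaqHol p) continuous_const
  have hWm : MeasurableSet W := hWopen.measurableSet
  have hO₃m : MeasurableSet O₃ := measurableSet_multiWindow F γ b₀ p₀ j K
  -- the slices of the chart
  have hΦV : ∀ V, Measurable fun z => Φ (V, z) := fun V => hΦ.comp measurable_prodMk_left
  have hJV : ∀ V, Measurable fun z => J (V, z) := fun V => hJ.comp measurable_prodMk_left
  -- the fibre package
  let lam : GaugeField (F.P j) 0 ↥(Matrix.specialUnitaryGroup (Fin 2) ℂ) →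
      Measure (GaugeField (F.P K) 0 ↥(Matrix.specialUnitaryGroup (Fin 2) ℂ)) :=
    fun V => if V ∈ W then ((τ.withDensity fun z => (J (V, z) : ℝ≥0∞)).map fun z => Φ (V, z)) else 0
  have hlamW : ∀ V, V ∈ W → lam V = (τ.withDensity fun z => (J (V, z) : ℝ≥0∞)).map fun z => Φ (V, z) :=
    fun V hV => if_pos hV
  -- total mass on the window is finite
  have hJlin : ∀ V, V ∈ W → ∫⁻ z, (J (V, z) : ℝ≥0∞) ∂τ < ⊤ := by
    intro V hV
    have h1 : ∫⁻ z, (J (V, z) : ℝ≥0∞) ∂τ ≤ ∫⁻ z, ENNReal.ofReal (B z) ∂τ := by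
      refine lintegral_mono_ae ?_
      filter_upwards [hJB V hV] with z hz
      rw [← ENNReal.ofReal_coe_nnreal]
      exact ENNReal.ofReal_le_ofReal hz
    exact lt_of_le_of_lt h1 hB.lintegral_lt_top
  have hfin : ∀ V, IsFiniteMeasure (lam V) := by
    intro V
    by_cases hV : V ∈ W
    · rw [hlamW V hV]
      haveI : IsFiniteMeasure (τ.withDensity fun z => (J (V, z) : ℝ≥0∞)) :=
        isFiniteMeasure_withDensity (hJlin V hV).ne
      exact Measure.isFiniteMeasure_map _ _
    · simp only [lam, hV, if_false]
      infer_instance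
  -- integrals against the fibre package = chart integrals
  have hlamint : ∀ V, V ∈ W → ∀ f : GaugeField (F.P K) 0 ↥(Matrix.specialUnitaryGroup (Fin 2) ℂ) → ℝ,
      Continuous f → ∫ U, f U ∂(lam V) = ∫ z, (J (V, z) : ℝ) * f (Φ (V, z)) ∂τ := by
    intro V hV f hf
    rw [hlamW V hV, integral_map (hΦV V).aemeasurable hf.aestronglyMeasurable,
      integral_withDensity_eq_integral_smul (hJV V)]
    rfl
  -- a sup bound for a continuous function on the compact fine space
  have hbdd : ∀ f : GaugeField (F.P K) 0 ↥(Matrix.specialUnitaryGroup (Fin 2) ℂ) → ℝ, Continuous f →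
      ∃ C : ℝ, 0 ≤ C ∧ ∀ U, ‖f U‖ ≤ C := by
    intro f hf
    obtain ⟨C, hC⟩ := isCompact_univ.exists_bound_of_continuousOn hf.continuousOn
    exact ⟨max C 0, le_max_right _ _, fun U => (hC U (mem_univ U)).trans (le_max_left _ _)⟩
  refine ⟨lam, hfin, ?_, ?_, ?_⟩
  · -- (A1-MW) continuity of the fibre integrals on the window (dominated convergence)
    intro f hf hsupp
    obtain ⟨C, hC0, hC⟩ := hbdd f hf
    have hfm : Measurable f := hf.measurable
    have hcont : ContinuousOn (fun V => ∫ z, (J (V, z) : ℝ) * f (Φ (V, z)) ∂τ) W := by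
      refine Node00.continuousOn_fibreIntegral_of_dominated (U := W) (Φ := Φ) (J := J) (ρ := f) ?_ (fun z => B z * C)
        (hB.mul_const C) ?_ (hint f hf hsupp)
      · intro V _
        exact ((hJV V).coe_nnreal_real.mul (hfm.comp (hΦV V))).aestronglyMeasurable
      · intro V hV
        filter_upwards [hJB V hV] with z hz
        rw [norm_mul, Real.norm_eq_abs, abs_of_nonneg (J (V, z)).coe_nonneg]
        exact mul_le_mul hz (hC _) (norm_nonneg _) ((J (V, z)).coe_nonneg.trans hz)
    exact hcont.congr fun V hV => hlamint V hV f hf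
  · -- (A2-MW) positive mass of the multi-level window
    intro V hV
    rw [hlamW V hV, Measure.map_apply (hΦV V) hO₃m, withDensity_apply _ ((hΦV V) hO₃m)]
    exact hmass V hV
  · -- (A3-MW) proportionality to the disintegration, with the weight `(dν/dU_j)⁻¹`
    have hac : ν ≪ Hc := absolutelyContinuous_map_descendTo F j K hjK
    have hνeq : Hc.withDensity (ν.rnDeriv Hc) = ν := Measure.withDensity_rnDeriv_eq ν Hc hac
    have hpos : ∀ᵐ V ∂ν, 0 < ν.rnDeriv Hc V := Measure.rnDeriv_pos hac
    have hltc : ∀ᵐ V ∂Hc, ν.rnDeriv Hc V < ⊤ := Measure.rnDeriv_lt_top ν Hc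
    have hlt : ∀ᵐ V ∂ν, ν.rnDeriv Hc V < ⊤ := hac.ae_le hltc
    have hcp : ν ⊗ₘ σ₀ = Hf.map (fun U => (descendTo F ℰp j K hjK U, U)) :=
      compProd_eq_map_graph_of_bind Hf hd σ₀ hbind₀ hfib₀
    refine ⟨fun V => ((ν.rnDeriv Hc V).toReal)⁻¹, fun f hf hf0 => ?_⟩
    obtain ⟨C, hC0, hC⟩ := hbdd f hf
    have hfm : Measurable f := hf.measurable
    have hfi : Integrable f Hf := integrable_of_continuous_compact hf Hf
    have hS' : ∀ x, f x ≠ 0 → x ∈ S := fun x hx => hS x (by by_contra h; exact hx (hf0 x h))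
    -- the fibre mean `I V := ∫ f dσ₀_V`: strongly measurable and bounded
    set I : GaugeField (F.P j) 0 ↥(Matrix.specialUnitaryGroup (Fin 2) ℂ) → ℝ := fun V => ∫ U, f U ∂(σ₀ V) with hI
    have hIm : StronglyMeasurable I := hf.stronglyMeasurable.integral_kernel
    have hIbd : ∀ V, ‖I V‖ ≤ C := by
      intro V
      have h1 := norm_integral_le_of_norm_le_const (μ := σ₀ V) (f := f) (Eventually.of_forall fun U => hC U)
      simpa using h1
    -- integrability on the window of both candidates
    have hρ₁ : Integrable (fun V => (ν.rnDeriv Hc V).toReal * I V) Hc := by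
      have h1 : Integrable (fun V => I V * (ν.rnDeriv Hc V).toReal) Hc :=
        (Measure.integrable_toReal_rnDeriv).bdd_mul hIm.aestronglyMeasurable (Eventually.of_forall hIbd)
      exact h1.congr (Eventually.of_forall fun V => mul_comm _ _)
    have hρ₂ : IntegrableOn (fun V => ∫ z, (J (V, z) : ℝ) * f (Φ (V, z)) ∂τ) W Hc :=
      Node00.integrableOn_fibreIntegral_of_fibredChart (U := W) hΦ hJ hmap hfi
    -- the test identity
    have key : ∀ g : GaugeField (F.P j) 0 ↥(Matrix.specialUnitaryGroup (Fin 2) ℂ) → ℝ, Measurable g →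
        (∃ Cg : ℝ, ∀ V, |g V| ≤ Cg) → (∀ V, V ∉ W → g V = 0) →
        ∫ V, ((ν.rnDeriv Hc V).toReal * I V) * g V ∂Hc = ∫ V, (∫ z, (J (V, z) : ℝ) * f (Φ (V, z)) ∂τ) * g V ∂Hc := by
      intro g hg hCg hg0
      obtain ⟨Cg, hCg'⟩ := hCg
      have h1 := Node00.integral_mul_comp_eq_integral_fibreIntegral_mul (ν := Hf) (μ := Hc) (τ := τ) (U := W) (S := S)
        (Φ := Φ) (J := J) hWm hd hΦ hJ havgΦ hmap hfi hS' hg ⟨Cg, hCg'⟩ hg0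
      rw [← h1]
      -- LHS through the density, the compProd form and the graph map
      have h2 : ∫ V, ((ν.rnDeriv Hc V).toReal * I V) * g V ∂Hc = ∫ V, I V * g V ∂ν := by
        conv_rhs => rw [← hνeq]
        rw [integral_withDensity_eq_integral_toReal_smul (Measure.measurable_rnDeriv _ _) hltc]
        refine integral_congr_ae (Eventually.of_forall fun V => ?_)
        simp only [smul_eq_mul]
        ring
      have hint' : Integrable (fun p : GaugeField (F.P j) 0 ↥(Matrix.specialUnitaryGroup (Fin 2) ℂ) ×
          GaugeField (F.P K) 0 ↥(Matrix.specialUnitaryGroup (Fin 2) ℂ) => f p.2 * g p.1) (ν ⊗ₘ σ₀) := by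
        refine Integrable.mono' (integrable_const (C * Cg))
          ((hfm.comp measurable_snd).mul (hg.comp measurable_fst)).aestronglyMeasurable
          (Eventually.of_forall fun p => ?_)
        rw [norm_mul]
        exact mul_le_mul (hC _) (by simpa [Real.norm_eq_abs] using hCg' p.1) (norm_nonneg _) hC0
      have h3 : ∫ V, I V * g V ∂ν = ∫ p, f p.2 * g p.1 ∂(ν ⊗ₘ σ₀) := by
        rw [Measure.integral_compProd hint']
        refine integral_congr_ae (Eventually.of_forall fun V => ?_)
        simp only [hI]
        rw [← integral_mul_const]
      have h4 : ∫ p, f p.2 * g p.1 ∂(ν ⊗ₘ σ₀) = ∫ U, f U * g (descendTo F ℰp j K hjK U) ∂Hf := by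
        rw [hcp]
        exact integral_map (hd.prodMk measurable_id').aemeasurable
          ((hfm.comp measurable_snd).mul (hg.comp measurable_fst)).aestronglyMeasurable
      rw [h2, h3, h4]
    have hae := Node00.ae_eq_restrict_of_forall_integral_mul_eq hWm hρ₁.integrableOn hρ₂ key
    have hae' : ∀ᵐ V ∂Hc, V ∈ W → (ν.rnDeriv Hc V).toReal * I V = ∫ z, (J (V, z) : ℝ) * f (Φ (V, z)) ∂τ :=
      (ae_restrict_iff' hWm).1 hae
    filter_upwards [hac.ae_le hae', hpos, hlt] with V hVeq hVpos hVlt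
    intro hVW
    have hr : 0 < (ν.rnDeriv Hc V).toReal := ENNReal.toReal_pos hVpos.ne' hVlt.ne
    refine ⟨inv_pos.mpr hr, ?_⟩
    rw [hlamint V hVW f hf, ← hVeq hVW, ← mul_assoc, inv_mul_cancel₀ hr.ne', one_mul]

/-! ## §3 From a height, for every family and every depth: no residual letter -/

/-- ★★★ **THE m-STEP (A)-PACKAGE OF `descendTo F ℰp j K` ON THE MULTI-LEVEL WINDOW, FROM A HEIGHT, FOR EVERY DISINTEGRATION** (`∀ σ₀` edition): §2 ∘ ✓(L15-MW)
`exists_height_fibredChart_descendTo`. [cite: Balaban1987RG1, (0.11) p.253 and (2.10) p.267; Balaban1985Averaging, (10)-(13) p.19; Balaban1985UV3, (7) p.257] -/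
theorem exists_height_regularPackage_descendTo_forall
    (F : T3Family) (γ b₀ p₀ : ℝ) (hγ : 0 < γ) (hγ1 : γ ≤ 1) (hb₀ : 0 < b₀) (hp₀ : 0 < p₀) :
    ∃ jA : ℕ, ∀ (j : ℕ), jA ≤ j → ∀ (K : ℕ) (hjK : j + 1 ≤ K),
      ∀ (σ₀ : Kernel (GaugeField (F.P j) 0 ↥(Matrix.specialUnitaryGroup (Fin 2) ℂ))
          (GaugeField (F.P K) 0 ↥(Matrix.specialUnitaryGroup (Fin 2) ℂ))),
        IsMarkovKernel σ₀ →
        (Measure.map (descendTo F ℰp j K (Nat.le_of_succ_le hjK)) (fieldMeasure (F.P K) 0 ↥(Matrix.specialUnitaryGroup (Fin 2) ℂ))).bind ⇑σ₀ =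
          fieldMeasure (F.P K) 0 ↥(Matrix.specialUnitaryGroup (Fin 2) ℂ) →
        (∀ᵐ V ∂(Measure.map (descendTo F ℰp j K (Nat.le_of_succ_le hjK)) (fieldMeasure (F.P K) 0 ↥(Matrix.specialUnitaryGroup (Fin 2) ℂ))),
          ∀ᵐ U ∂(σ₀ V), descendTo F ℰp j K (Nat.le_of_succ_le hjK) U = V) →
        ∃ lam : GaugeField (F.P j) 0 ↥(Matrix.specialUnitaryGroup (Fin 2) ℂ) →
            Measure (GaugeField (F.P K) 0 ↥(Matrix.specialUnitaryGroup (Fin 2) ℂ)),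
          (∀ V, IsFiniteMeasure (lam V)) ∧
          (∀ f : GaugeField (F.P K) 0 ↥(Matrix.specialUnitaryGroup (Fin 2) ℂ) → ℝ, Continuous f →
            (∀ U, f U ≠ 0 → ∀ (n : ℕ) (hjn : j + 1 ≤ n) (hnK : n ≤ K), PlaqSmall (24 / 25 * θBal F.L γ b₀ p₀ n) (descendTo F ℰp n K hnK U)) →
            ContinuousOn (fun V => ∫ U, f U ∂(lam V)) {V | PlaqSmall (θBal F.L γ b₀ p₀ j) V}) ∧
          (∀ V, PlaqSmall (θBal F.L γ b₀ p₀ j) V → 0 < lam V {U | ∀ (n : ℕ) (hjn : j + 1 ≤ n) (hnK : n ≤ K),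
            PlaqSmall (24 / 25 * θBal F.L γ b₀ p₀ n) (descendTo F ℰp n K hnK U)}) ∧
          (∃ c : GaugeField (F.P j) 0 ↥(Matrix.specialUnitaryGroup (Fin 2) ℂ) → ℝ,
            ∀ f : GaugeField (F.P K) 0 ↥(Matrix.specialUnitaryGroup (Fin 2) ℂ) → ℝ, Continuous f →
              (∀ U, ¬ (∀ (n : ℕ) (hjn : j + 1 ≤ n) (hnK : n ≤ K), PlaqSmall (24 / 25 * θBal F.L γ b₀ p₀ n) (descendTo F ℰp n K hnK U)) → f U = 0) →
              ∀ᵐ V ∂(Measure.map (descendTo F ℰp j K (Nat.le_of_succ_le hjK)) (fieldMeasure (F.P K) 0 ↥(Matrix.specialUnitaryGroup (Fin 2) ℂ))),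
                PlaqSmall (θBal F.L γ b₀ p₀ j) V → 0 < c V ∧ ∫ U, f U ∂(σ₀ V) = c V * ∫ U, f U ∂(lam V)) := by
  classical
  obtain ⟨jA, hjA⟩ := exists_height_fibredChart_descendTo F γ b₀ p₀ hγ hγ1 hb₀ hp₀
  refine ⟨jA, fun j hj K hjK σ₀ hσ₀M hbind₀ hfib₀ => ?_⟩
  obtain ⟨Z, mZ, τ, Φ, J, S, B, hτ, hΦm, hJm, hSm, hS, havgΦ, hmap, hint, hJB, hmass⟩ := hjA j hj K hjK
  haveI : BorelSpace (GaugeField (F.P j) 0 ↥(Matrix.specialUnitaryGroup (Fin 2) ℂ)) := T3OrbitAverage.instBorelSpaceGaugeField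
  have hWm : MeasurableSet {V : GaugeField (F.P j) 0 ↥(Matrix.specialUnitaryGroup (Fin 2) ℂ) | PlaqSmall (θBal F.L γ b₀ p₀ j) V} := by
    have e : {V : GaugeField (F.P j) 0 ↥(Matrix.specialUnitaryGroup (Fin 2) ℂ) | PlaqSmall (θBal F.L γ b₀ p₀ j) V} =
        ⋂ p : Plaq (F.P j) 0, {U | dist1 (GaugeField.plaqHol U p) < θBal F.L γ b₀ p₀ j} := by
      ext U; simp only [PlaqSmall, Set.mem_setOf_eq, Set.mem_iInter]
    rw [e]
    exact (isOpen_iInter_of_finite fun p => isOpen_lt (continuous_dist1_plaqHol p) continuous_const).measurableSet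
  exact regularPackage_descendTo_of_fibredChart F γ b₀ p₀ j K (Nat.le_of_succ_le hjK) σ₀ hσ₀M hbind₀ hfib₀ τ Φ hΦm J hJm S hS
    (fun V _ z => havgΦ V z) (hmap _ hWm) (fun f hf hsupp => Eventually.of_forall (hint f hf hsupp))
    (fun _ => B) (integrable_const _) (fun V _ => Eventually.of_forall (fun z => hJB V z)) hmass

/-- **THE DISINTEGRATION OF PRODUCT HAAR ALONG `descendTo F ℰp j K`, WITH ITS THREE LETTERS** (Markov; `bind`; fibre) — `T4AveragingDisintegration.condLaw` on the standard Borel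
fine space, as ✓`OrganTangentAPackageAtDescend.exists_descentDisintegration` for one step. [cite: Balaban1985Averaging, (10)-(13) p.19] -/
theorem exists_descentDisintegration_descendTo (F : T3Family) (j K : ℕ) (hjK : j ≤ K) :
    ∃ σ : Kernel (GaugeField (F.P j) 0 ↥(Matrix.specialUnitaryGroup (Fin 2) ℂ)) (GaugeField (F.P K) 0 ↥(Matrix.specialUnitaryGroup (Fin 2) ℂ)),
      IsMarkovKernel σ ∧
        (Measure.map (descendTo F ℰp j K hjK) (fieldMeasure (F.P K) 0 ↥(Matrix.specialUnitaryGroup (Fin 2) ℂ))).bind ⇑σ =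
            fieldMeasure (F.P K) 0 ↥(Matrix.specialUnitaryGroup (Fin 2) ℂ) ∧
          ∀ᵐ V ∂(Measure.map (descendTo F ℰp j K hjK) (fieldMeasure (F.P K) 0 ↥(Matrix.specialUnitaryGroup (Fin 2) ℂ))),
            ∀ᵐ U ∂(σ V), descendTo F ℰp j K hjK U = V := by
  have havg : Measurable (descendTo F ℰp j K hjK : GaugeField (F.P K) 0 ↥(Matrix.specialUnitaryGroup (Fin 2) ℂ) → GaugeField (F.P j) 0 ↥(Matrix.specialUnitaryGroup (Fin 2) ℂ)) :=
    measurable_descendTo F ℰp measurableE_ℰp hjK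
  haveI : Nonempty (GaugeField (F.P K) 0 ↥(Matrix.specialUnitaryGroup (Fin 2) ℂ)) := ⟨fun _ => 1⟩
  refine ⟨T4AveragingDisintegration.condLaw (fieldMeasure (F.P K) 0 ↥(Matrix.specialUnitaryGroup (Fin 2) ℂ)) (descendTo F ℰp j K hjK), inferInstance, ?_, ?_⟩
  · have h := T4AveragingDisintegration.fst_compProd_condLaw (fieldMeasure (F.P K) 0 ↥(Matrix.specialUnitaryGroup (Fin 2) ℂ)) (descendTo F ℰp j K hjK)
    rw [T4AveragingDisintegration.jointLaw_fst _ havg] at h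
    have h2 := congrArg Measure.snd h
    rw [Measure.snd_compProd, T4AveragingDisintegration.jointLaw_snd _ havg] at h2
    exact h2
  · filter_upwards [T4AveragingDisintegration.condLaw_fibre_ae (fieldMeasure (F.P K) 0 ↥(Matrix.specialUnitaryGroup (Fin 2) ℂ)) havg] with V hV
    rw [ae_iff]
    exact (prob_compl_eq_zero_iff (measurableSet_eq_fun havg measurable_const)).2 hV

/-- ★★★ **THE m-STEP (A)-PACKAGE OF `descendTo F ℰp j K` ON THE MULTI-LEVEL WINDOW HOLDS FROM A HEIGHT, UNCONDITIONALLY** (`∃ σ₀ lam` edition, no residual letter): for every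
family `F`, every `0 < γ ≤ 1`, `0 < b₀`, `0 < p₀`, every `K ≥ j+1 ≥ jA+1`. [cite: Balaban1987RG1, (0.11) p.253 and (2.10) p.267; Balaban1985Averaging, (10)-(13) p.19; Balaban1985UV3, (7) p.257] -/
theorem exists_height_regularSmallFieldDisintegration_descendTo
    (F : T3Family) (γ b₀ p₀ : ℝ) (hγ : 0 < γ) (hγ1 : γ ≤ 1) (hb₀ : 0 < b₀) (hp₀ : 0 < p₀) :
    ∃ jA : ℕ, ∀ (j : ℕ), jA ≤ j → ∀ (K : ℕ) (hjK : j + 1 ≤ K),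
      ∃ (σ₀ : Kernel (GaugeField (F.P j) 0 ↥(Matrix.specialUnitaryGroup (Fin 2) ℂ))
          (GaugeField (F.P K) 0 ↥(Matrix.specialUnitaryGroup (Fin 2) ℂ)))
        (lam : GaugeField (F.P j) 0 ↥(Matrix.specialUnitaryGroup (Fin 2) ℂ) →
          Measure (GaugeField (F.P K) 0 ↥(Matrix.specialUnitaryGroup (Fin 2) ℂ))),
        IsMarkovKernel σ₀ ∧
        (Measure.map (descendTo F ℰp j K (Nat.le_of_succ_le hjK)) (fieldMeasure (F.P K) 0 ↥(Matrix.specialUnitaryGroup (Fin 2) ℂ))).bind ⇑σ₀ =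
          fieldMeasure (F.P K) 0 ↥(Matrix.specialUnitaryGroup (Fin 2) ℂ) ∧
        (∀ᵐ V ∂(Measure.map (descendTo F ℰp j K (Nat.le_of_succ_le hjK)) (fieldMeasure (F.P K) 0 ↥(Matrix.specialUnitaryGroup (Fin 2) ℂ))),
          ∀ᵐ U ∂(σ₀ V), descendTo F ℰp j K (Nat.le_of_succ_le hjK) U = V) ∧
        (∀ V, IsFiniteMeasure (lam V)) ∧
        (∀ f : GaugeField (F.P K) 0 ↥(Matrix.specialUnitaryGroup (Fin 2) ℂ) → ℝ, Continuous f →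
          (∀ U, f U ≠ 0 → ∀ (n : ℕ) (hjn : j + 1 ≤ n) (hnK : n ≤ K), PlaqSmall (24 / 25 * θBal F.L γ b₀ p₀ n) (descendTo F ℰp n K hnK U)) →
          ContinuousOn (fun V => ∫ U, f U ∂(lam V)) {V | PlaqSmall (θBal F.L γ b₀ p₀ j) V}) ∧
        (∀ V, PlaqSmall (θBal F.L γ b₀ p₀ j) V → 0 < lam V {U | ∀ (n : ℕ) (hjn : j + 1 ≤ n) (hnK : n ≤ K),
          PlaqSmall (24 / 25 * θBal F.L γ b₀ p₀ n) (descendTo F ℰp n K hnK U)}) ∧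
        (∃ c : GaugeField (F.P j) 0 ↥(Matrix.specialUnitaryGroup (Fin 2) ℂ) → ℝ,
          ∀ f : GaugeField (F.P K) 0 ↥(Matrix.specialUnitaryGroup (Fin 2) ℂ) → ℝ, Continuous f →
            (∀ U, ¬ (∀ (n : ℕ) (hjn : j + 1 ≤ n) (hnK : n ≤ K), PlaqSmall (24 / 25 * θBal F.L γ b₀ p₀ n) (descendTo F ℰp n K hnK U)) → f U = 0) →
            ∀ᵐ V ∂(Measure.map (descendTo F ℰp j K (Nat.le_of_succ_le hjK)) (fieldMeasure (F.P K) 0 ↥(Matrix.specialUnitaryGroup (Fin 2) ℂ))),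
              PlaqSmall (θBal F.L γ b₀ p₀ j) V → 0 < c V ∧ ∫ U, f U ∂(σ₀ V) = c V * ∫ U, f U ∂(lam V)) := by
  obtain ⟨jA, hjA⟩ := exists_height_regularPackage_descendTo_forall F γ b₀ p₀ hγ hγ1 hb₀ hp₀
  refine ⟨jA, fun j hj K hjK => ?_⟩
  obtain ⟨σ₀, hσ₀M, hbind₀, hfib₀⟩ := exists_descentDisintegration_descendTo F j K (Nat.le_of_succ_le hjK)
  obtain ⟨lam, hlam, hA1, hA2, hA3⟩ := hjA j hj K hjK σ₀ hσ₀M hbind₀ hfib₀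
  exact ⟨σ₀, lam, hσ₀M, hbind₀, hfib₀, hlam, hA1, hA2, hA3⟩

end Summit.QuantumFields.YangMills.Theorems.FluctuationComparisonRegPrIntLOrganTangentAPackageDescendTo

end
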